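import Summits.AtomisticToContinuum.BoseEinsteinCondensation.Theorems.BECThomsonPrincipleGaussianDominationCanTruncatedEnergyLSCOfMaxFormBound
import Summits.AtomisticToContinuum.BoseEinsteinCondensation.Theorems.BECThomsonPrincipleGaussianDominationCanChordTransport
import Summits.AtomisticToContinuum.BoseEinsteinCondensation.Theorems.BECThomsonPrincipleGaussianDominationCanFreeCase
import Literature.MathematicalPhysics.QuantumManyBody.PeriodicMaxFormBoundHardCore
import HarnessLib

/-!
# `GaussianDominationCan`: hard cores removed, and the crux reduced to ONE sign for EVERY admissible potential

Route `BECThomsonPrinciple`, crux `GaussianDominationCan` (stmt-AtomisticToContinuum-9479).  Supports (does not close)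
the item.  Written by the crux-strategist seat (2026-08-17) as the glue of its strategy census
(`Cruxes/GaussianDominationCan/STRATEGY-CENSUS.md`); no new definitions, no new statements.

The Literature theorem `maxFormBound_of_isRepulsiveFiniteRange`
(`Literature/MathematicalPhysics/QuantumManyBody/PeriodicMaxFormBoundHardCore.lean`, landed 2026-08-16 17:38Z, after the
last lead seat on this crux) is VERBATIM the statement of the registered open stub D2a `stub_maxFormBound` of the skeleton of
record `Cruxes/GaussianDominationCan/Lines/coupling_monotone_chord.lean` (r5) — the periodic Bose `C¹` class realises the
infimum of the maximal form also for hard cores.  Consequences proved here (all [folklore]-level compositions of landed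
theorems):

* `truncatedEnergyLSC_holds : TruncatedEnergyLSC` — at fixed `(N, L)`, `E₀(v) ≤ ⨆_{h>0} E₀(min(v,h))` for EVERY repulsive
  finite-range `v` (hard cores, non-integrable profiles included): D2 of the line is a theorem.
* `truncationLimit_holds : TruncationLimit` — chord bodies of all bounded truncations `min(v,h)` with a COMMON constant give
  the chord body of `v`: **hard cores are deleted from the crux for every line**, not only for the coupling line.
* `isRepulsiveFiniteRange_trunc`, `trunc_bounded` — each truncation is an admissible BOUNDED potential of the same range, so a
  line may assume boundedness (e.g. the route's `FibreConductance`, typed for bounded `v` only) provided its constants are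
  uniform along `h`.
* `gdCanWith_of_truncations`, `gaussianDominationCan_of_truncations` — the crux in `GDCanWith` form, resp. BY NAME, from its
  truncation-uniform bounded instances.
* `gaussianDominationCan_of_sourceRaisesInteraction : SourceRaisesInteraction → GaussianDominationCan` — **the crux is now
  reduced, kernel-checked, to the single sign B (`SourceRaisesInteraction`) for ALL admissible `v`** (previously: for bounded
  `v`, `gdCan_bounded_of_sourceRaisesInteraction`; for all `v` modulo D2a).  B is the open `T = 0` content of the crux at its
  sharpest (`Lines/coupling-monotone-chord-dead.md`); this file does not touch it.

References: B. Simon, J. Operator Theory 1 (1979) 37–47, Thm 2.1; [ReedSimonIV1978] Thm XIII.64; [LSSY2005] App. A;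
M. Lewin, P. T. Nam, S. Serfaty, J. P. Solovej, arXiv:1211.2778 (the excitation operator of the source).
-/

noncomputable section

namespace Summit.AtomisticToContinuum.BoseEinsteinCondensation.Cruxes.GaussianDominationCan.CouplingMonotoneChord

open MeasureTheory
open scoped ENNReal NNReal
open Literature.MathematicalPhysics.QuantumManyBody.BoseGas
open Summit.AtomisticToContinuum.BoseEinsteinCondensation.Theses
open Summit.AtomisticToContinuum.BoseEinsteinCondensation.Theorems.GaussianDominationCan.Negative
  (GDIneq InWindow GDCanWith gaussianDominationCan_iff)

/-! ## D2 is a theorem: lower semicontinuity of `E₀` under truncation, every admissible `v` -/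

/-- **`TruncatedEnergyLSC` holds** (the line's D2; D2a `stub_maxFormBound` = the Literature theorem
`maxFormBound_of_isRepulsiveFiniteRange`, D2b = the landed reduction `stub_truncatedEnergyLSC_of_maxFormBound`):
for every repulsive finite-range `v`, `N = m+1`, `L > 0`, `E₀(v) ≤ ⨆_{h>0} E₀(min(v, h))`. [folklore] -/
theorem truncatedEnergyLSC_holds : TruncatedEnergyLSC :=
  stub_truncatedEnergyLSC_of_maxFormBound maxFormBound_of_isRepulsiveFiniteRange

/-- **`TruncationLimit` holds**: at fixed `(N, L, n)` and `C > 0`, if every bounded truncation `min(v,h)`, `h > 0`, satisfies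
the chord body with constant `C`, then so does `v` — hard cores are the monotone limit of bounded potentials for the crux's
chord inequality. [folklore] -/
theorem truncationLimit_holds : TruncationLimit :=
  truncationLimit_of_lsc truncatedEnergyLSC_holds

/-! ## Truncations are admissible and bounded -/

/-- A truncation `min(v, h)` of a repulsive finite-range potential is repulsive finite-range (same range). [folklore] -/
theorem isRepulsiveFiniteRange_trunc {v : ℝ → ℝ≥0∞} (hv : IsRepulsiveFiniteRange v) (h : ℝ) :
    IsRepulsiveFiniteRange (trunc v h) := by
  obtain ⟨hmeas, R₀, hR₀⟩ := hv
  refine ⟨hmeas.min measurable_const, R₀, fun r hr => ?_⟩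
  show min (v r) (ENNReal.ofReal h) = 0
  rw [hR₀ r hr]
  simp

/-- A truncation `min(v, h)` is a bounded potential. [folklore] -/
theorem trunc_bounded (v : ℝ → ℝ≥0∞) (h : ℝ) : ∃ B : ℝ, ∀ r, trunc v h r ≤ ENNReal.ofReal B :=
  ⟨h, trunc_le v h⟩

/-! ## The crux from its bounded, truncation-uniform instances -/

/-- **`GDCanWith` passes to the monotone limit of truncations**: if the bounded truncations `min(v,h)`, `h > 0`, satisfy
`GDCanWith ρ₀ C N₀ · M` with the SAME data `(ρ₀, C, N₀)`, then so does `v`. [folklore] -/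
theorem gdCanWith_of_truncations {ρ₀ C : ℝ} {N₀ : ℕ} {v : ℝ → ℝ≥0∞} (hv : IsRepulsiveFiniteRange v) {M : ℝ}
    (hC : 0 < C) (htr : ∀ h : ℝ, 0 < h → GDCanWith ρ₀ C N₀ (trunc v h) M) : GDCanWith ρ₀ C N₀ v M :=
  fun m hm L hL hd n hn hw =>
    truncationLimit_holds v hv m L hL n hn C hC fun h hh => htr h hh m hm L hL hd n hn hw

/-- **The crux BY NAME from its truncation-uniform bounded instances**: it suffices to prove `GaussianDominationCan` for the
BOUNDED admissible potentials `min(v, h)` with constants `(ρ₀, C, N₀)` depending on `(v, M)` but not on the truncation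
height `h`. [folklore] -/
theorem gaussianDominationCan_of_truncations
    (htr : ∀ v : ℝ → ℝ≥0∞, IsRepulsiveFiniteRange v → ∀ M : ℝ, 0 < M →
      ∃ ρ₀ C : ℝ, 0 < ρ₀ ∧ 0 < C ∧ ∃ N₀ : ℕ, ∀ h : ℝ, 0 < h → GDCanWith ρ₀ C N₀ (trunc v h) M) :
    BECThomsonPrinciple.GaussianDominationCan :=
  gaussianDominationCan_iff.mpr fun v hv M hM => by
    obtain ⟨ρ₀, C, hρ₀, hC, N₀, hh⟩ := htr v hv M hM
    exact ⟨ρ₀, C, hρ₀, hC, N₀, gdCanWith_of_truncations hv hC hh⟩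

/-! ## The crux from the single sign B, every admissible potential -/

/-- **`GaussianDominationCan` ⟸ `SourceRaisesInteraction` for EVERY repulsive finite-range potential (hard cores included),
with the sharp constant**: the composition `stub_compose` of the landed stubs A1 `stub_modeBessel`, A2 `stub_thetaNorm`,
A3 `stub_freeAnchorOf`, C `stub_chordTransport` and the now-proved D2 `truncatedEnergyLSC_holds`, leaving exactly the sign
B as hypothesis.  (B is believed true and is at least as strong as the crux for bounded potentials:
`gdCan_bounded_of_sourceRaisesInteraction`, `Negative.free_const_ge`.) [folklore] -/
theorem gaussianDominationCan_of_sourceRaisesInteraction (hB : SourceRaisesInteraction) :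
    BECThomsonPrinciple.GaussianDominationCan :=
  stub_compose stub_modeBessel stub_thetaNorm stub_freeAnchorOf hB stub_chordTransport truncatedEnergyLSC_holds

/-- The same in `GDCanWith` form with the data exposed: `ρ₀ = ρ₀_B(M, R₀(v))`, `C = 1/(4π²)` (sharp), `N₀ = 0`
(the proof of `gaussianDominationCan_of_parts` with `TruncationLimit` now discharged). [folklore] -/
theorem gdCanWith_sharp_of_sourceRaisesInteraction (hB : SourceRaisesInteraction) :
    ∀ v : ℝ → ℝ≥0∞, IsRepulsiveFiniteRange v → ∀ M : ℝ, 0 < M →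
      ∃ ρ₀ : ℝ, 0 < ρ₀ ∧ GDCanWith ρ₀ (1 / (4 * Real.pi ^ 2)) 0 v M := by
  intro v hv M hM
  obtain ⟨hmeas, R₀, hR₀⟩ := hv
  obtain ⟨ρ₀, hρ₀, hSRI⟩ := hB M hM R₀
  refine ⟨ρ₀, hρ₀, ?_⟩
  intro m _ L hL hdens n hn hwin
  change GDChordBody v (1 / (4 * Real.pi ^ 2)) m L n
  refine truncationLimit_holds v ⟨hmeas, R₀, hR₀⟩ m L hL n hn _ (by positivity) fun h _ => ?_
  have hmeas' : Measurable (trunc v h) := hmeas.min measurable_const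
  have hrange : ∀ r, R₀ < r → trunc v h r = 0 := fun r hr => by
    show min (v r) (ENNReal.ofReal h) = 0
    rw [hR₀ r hr]
    simp
  refine stub_chordTransport (trunc v h) ⟨hmeas', R₀, hrange⟩ ⟨h, trunc_le v h⟩ m L hL n hn ?_ _ (by positivity)
    (stub_freeAnchorOf stub_modeBessel stub_thetaNorm m L hL n hn)
  intro τ hτ _
  have hmeasτ : Measurable (scalePot τ (trunc v h)) := by
    unfold scalePot
    exact hmeas'.const_mul _
  have hrangeτ : ∀ r, R₀ < r → scalePot τ (trunc v h) r = 0 := fun r hr => by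
    show ENNReal.ofReal τ * trunc v h r = 0
    rw [hrange r hr, mul_zero]
  exact hSRI (scalePot τ (trunc v h)) hmeasτ hrangeτ ⟨τ * h, scalePot_le hτ.le (trunc_le v h)⟩
    m L hL hdens n hn hwin

end Summit.AtomisticToContinuum.BoseEinsteinCondensation.Cruxes.GaussianDominationCan.CouplingMonotoneChord

end
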